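import Literature.Geometry.Lorentzian.MassInequalities
import Literature.Geometry.Lorentzian.CauchyDevelopment
import Literature.Geometry.Lorentzian.KerrSchild
import HarnessLib

/-!
# The rigid positive energy theorem: vanishing ADM energy forces Minkowski data

(family `gr`; named fact for stub S2 `NonposMassKerrEnded` of crux `TameEscapeToKerrEnds`,
route `ExactKerrEnds` of the final-state summit; companion of `positive_mass_theorem_spacetime`
of `MassInequalities.lean`, which vendors the INEQUALITY `E ≥ |P|` of the spacetime positive mass
theorem (Eichmair–Huang–Lee–Schoen 2016, Thm. 1) and explicitly no rigidity statement.)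

Beig–Chruściel, J. Math. Phys. 37 (1996) 1939–1961 (arXiv:gr-qc/9510015), **Theorem 4.1
((Rigid) positive energy theorem)**, verbatim: *Consider a data set `(Σ, g_ij, K_ij)`, with
`Σ = Σ_int ∪ ⋃_{i=1}^I Σ_i` for some `I < ∞`. Here we assume that `Σ_int` is compact, and that each
of the ends `Σ_i` is diffeomorphic to `ℝ³ ∖ B(R_i)` for some `R_i > 0`. In each of the ends the
fields `(g, K)` are assumed to satisfy `|g_ij − δ_ij| + |r ∂_k g_ij| + |r K_ij| ≤ C r^{−α}` for
some constants `C > 0` and `α > 1/2`. Suppose moreover that the quantities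
`2ρ := ³R + K² − K^{ij}K_ij`, `J^k := D_l(K^{kl} − K g^{kl})` satisfy
`√(g_ij J^i J^j) ≤ ρ ≤ C(1 + r)^{−3−ε}`, `ε > 0`. Then the ADM four-momentum `(m, p^i)` of any of
the asymptotic ends of `Σ` satisfies `m ≥ √(p_i p^i)`. If `m = 0`, then `ρ ≡ J^i ≡ 0`, and there
exists an isometric embedding `i` of `Σ` into Minkowski space-time `(ℝ⁴, η_{μν})` such that `K_ij`
represents the extrinsic curvature tensor of `i(Σ)` in `(M, η_{μν})`. Moreover `i(Σ)` is an
asymptotically flat Cauchy surface in `(ℝ⁴, η_{μν})`.*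

This file vendors the case `m = 0` (the rigidity statement) as the named fact
`positive_mass_rigidity_spacetime : Prop` (D-0014), in dimension `3`, in the vocabulary of the
tree: the conclusion "`Σ` embeds isometrically into Minkowski space-time with extrinsic curvature
`K`, onto a Cauchy surface" is `∃ 𝒟 : CauchyDevelopment D, 𝒟.toSpacetime = Minkowski.spacetime`
(`CauchyDevelopment.lean`: a smooth embedding `ι : X → ℝ⁴` with future unit normal `ν`,
`ι^* η = h`, `K_ν = k`, `ι(X)` a Cauchy hypersurface of `(ℝ⁴, η, ∂ₜ)` = `Minkowski.spacetime` of
`KerrSchild.lean`; the pattern of `Minkowski.vacuumCauchyDevelopment_toSpacetime`). Nothing is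
proved here.

## Hypotheses (those of the printed theorem, or stronger)

* *one end, compact interior*: `e : AFEnd X` with `e.IsSoleEnd` (the complement of a far region
  `{R' < ‖x‖} ≅ ℝ³ ∖ B(R')` is compact; `I = 1`);
* *decay (4.1)* `|g − δ| + |r∂g| + |rK| ≤ C r^{−α}`, `α > 1/2`: implied by asymptotic flatness of
  order `1`, `e.IsAsymptoticallyFlat D 1` (`h − δ = O₂(r⁻¹)`, `k = O₁(r⁻²)` in the chart of the end,
  i.e. `α = 1` with one more derivative on each field);
* *`√(g_ij JⁱJʲ) ≤ ρ`*: the dominant energy condition `D.SatisfiesDominantEnergyCondition` (our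
  `μ`, `J` are `ρ`, `J` up to the positive factor `8π`, `InitialData.lean`);
* *`ρ ≤ C(1 + r)^{−3−ε}`*: on the end this is `μ = O(r^{−3−q₀})`, the `m = 0` clause of
  `HasSourceDecay e D q₀` (`MassInequalities.lean`, which moreover controls `J` and one derivative);
  on the compact interior `μ` is continuous, hence bounded, for smooth data;
* *regularity*: the printed proof is written for `(g, K)` of finite (weighted Hölder)
  differentiability (Beig–Chruściel 1996, §5 and App. A); the data of the tree are `C^∞`;
* *`m = 0`*: `e.HasADMEnergy D 0` — the ADM energy flux limit of the end exists and vanishes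
  (under the printed hypotheses the ADM four-momentum is finite and well defined, loc. cit. after
  Thm. 4.1, so this is the printed hypothesis `m = 0`).

The printed theorem does not list orientability of `Σ` among its hypotheses (the conventions of
its §5 concern space-times); its Witten-type proof uses the spin structure of an oriented
`3`-manifold, and the statement for a non-orientable `Σ` follows from the oriented one applied to
the orientation double cover (two ends of vanishing mass, each end lifting isometrically, whereas
the conclusion forces a single end) — so the fact is stated, as printed, without it.

## Conclusion (that of the printed theorem, or weaker)

`∃ 𝒟 : CauchyDevelopment D, 𝒟.toSpacetime = Minkowski.spacetime`: an isometric (`ι^* η = h`)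
smooth embedding of `X` into `(ℝ⁴, η)` with second fundamental form `k` w.r.t. the future unit
normal (`∂ₜ`-oriented; the sign convention `K_ν(v, w) = +η(D_v ν, dι w)` of `InitialDataSet` is
immaterial for an existence statement, the time reflection `t ↦ −t` being an isometry of `η` that
reverses the future normal and the sign of the extrinsic curvature), whose image is a Cauchy
hypersurface (`LorentzianMetric.IsCauchyHypersurface`, O'Neill 1983, Def. 14.28). The clause
`ρ ≡ J ≡ 0` is dropped. For `C^∞` data the embedding of the printed proof (the Killing development
of the data by the covariantly constant Killing initial data `(N, Yⁱ)`, Beig–Chruściel 1996, §2–§4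
and App. A, identified with `(ℝ⁴, η)` through its universal cover) is `C^∞`.

## Why this source

For `3`-dimensional data with `k = O(r⁻²)` only — the Dafermos–Rodnianski admissible class
`h − (1 + 2M/r)δ = o₂(r⁻¹)`, `k = o₁(r⁻²)` of the final-state summit — the non-spinor proofs of the
`E = 0` rigidity (Schoen–Yau 1981; Eichmair 2013, Thm. 3; Huang–Lee 2020, Cor. 4) require the extra
decay `tr_g k = O(r^{−γ})`, `γ > 2`, which that class does not provide; Beig–Chruściel's spinorial
Theorem 4.1 asks only `|rK| ≤ C r^{−α}`, `α > 1/2`.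

## References

* R. Beig, P. T. Chruściel, *Killing vectors in asymptotically flat space-times. I. Asymptotically
  translational Killing vectors and the rigid positive energy theorem*, J. Math. Phys. 37 (1996)
  1939–1961, arXiv:gr-qc/9510015: Thm. 4.1 (§4), §5 (conventions `O_k(r^β)`), App. A.
  [BeigChrusciel1996]
* M. Eichmair, L.-H. Huang, D. A. Lee, R. Schoen, *The spacetime positive mass theorem in
  dimensions less than eight*, J. Eur. Math. Soc. 18 (2016) 83–121: Thm. 1 and p. 3 ("our main
  theorem does not include a rigidity statement"). [EichmairHuangLeeSchoen2016]
* M. Eichmair, *The Jang equation reduction of the spacetime positive energy theorem in dimensions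
  less than eight*, Comm. Math. Phys. 319 (2013) 575–593: Thm. 3 (the `E = 0` case under
  `tr_g k = O(|x|^{−γ})`, `γ > 2`, for `n = 3`).
* L.-H. Huang, D. A. Lee, *Equality in the spacetime positive mass theorem*, Comm. Math. Phys. 376
  (2020) 2379–2407: Thm. 1 and Cor. 4.
* E. Witten, *A new proof of the positive energy theorem*, Comm. Math. Phys. 80 (1981) 381–402;
  T. Parker, C. H. Taubes, *On Witten's proof of the positive energy theorem*, Comm. Math. Phys. 84
  (1982) 223–238 (the statement "if `E_l = 0` for some `l` then `M` has only one end and `N` is flat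
  along `M`", p. 225).
* B. O'Neill, *Semi-Riemannian geometry* (1983), Ch. 14, Def. 14.28 (Cauchy hypersurface).
-/

noncomputable section

open Bundle Set Manifold TopologicalSpace Filter
open scoped ContDiff Topology Manifold

namespace Literature.Geometry.Lorentzian

/-- **gr.S10** (rigid positive energy theorem: `m = 0` forces Minkowski data). Named fact:
Beig–Chruściel, J. Math. Phys. 37 (1996), Thm. 4.1 (§4), case `m = 0`: *for a data set
`(Σ, g, K)` with compact interior and finitely many ends `≅ ℝ³ ∖ B(Rᵢ)`, on which
`|g − δ| + |r∂g| + |rK| ≤ C r^{−α}` (`α > 1/2`) and `√(g_ij JⁱJʲ) ≤ ρ ≤ C(1 + r)^{−3−ε}`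
(`ε > 0`), if the ADM mass `m` of an end vanishes then there exists an isometric embedding `i` of
`Σ` into Minkowski space-time `(ℝ⁴, η)` such that `K_ij` represents the extrinsic curvature
tensor of `i(Σ)`; moreover `i(Σ)` is an asymptotically flat Cauchy surface in `(ℝ⁴, η)`.*
Hypotheses (those of the printed theorem or stronger, see the module docstring): the dominant
energy condition `|J|_h ≤ μ`; asymptotic flatness of order `1` on the end `e` (`α = 1`); source
decay `HasSourceDecay e D q₀` (`μ = O(r^{−3−q₀})` on the end; `μ` is bounded on the compact
rest); `e` is the only end (compact interior, one end); and `m = 0` in the honest form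
`e.HasADMEnergy D 0` (the ADM energy flux limit exists and is `0`). Conclusion, in the
vocabulary of `CauchyDevelopment.lean`: `D` has a Cauchy development WHICH IS Minkowski
space-time `(ℝ⁴, η, ∂ₜ)` (`Minkowski.spacetime`): a smooth embedding `ι : X → ℝ⁴` with future
unit normal `ν`, `ι^* η = h`, `K_ν = k`, and `ι(X)` a Cauchy hypersurface (O'Neill 1983,
Def. 14.28). The printed clause `ρ ≡ J ≡ 0` is dropped; orientability of `Σ` is not among the
printed hypotheses (the spinorial proof runs on the orientation double cover otherwise).
[cite: BeigChrusciel1996, Thm. 4.1 (§4), case m = 0] -/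
def positive_mass_rigidity_spacetime : Prop :=
  ∀ (X : Type) [TopologicalSpace X] [ChartedSpace E3 X] [IsManifold (𝓡 3) ∞ X] [T2Space X]
    [SecondCountableTopology X] [ConnectedSpace X]
    (D : InitialDataSet (𝓡 3) X) [D.metric.HasLeviCivita] (e : AFEnd X),
    D.SatisfiesDominantEnergyCondition → e.IsAsymptoticallyFlat D 1 →
    (∃ q₀, HasSourceDecay e D q₀) → e.IsSoleEnd → e.HasADMEnergy D 0 →
    ∃ 𝒟 : CauchyDevelopment D, 𝒟.toSpacetime = Minkowski.spacetime

end Literature.Geometry.Lorentzian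

end
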